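import Literature.AlgebraicGeometry.Motives.JacobianGaloisDescent
import Literature.AlgebraicGeometry.Resolution.BlowupsProduct
import Literature.AlgebraicGeometry.Resolution.StrictTransformOpenImmersion

/-!
# `DescentAlgclosedToPerfect` (stmt-ResolutionOfSingularities-0550), line `npc-fixed-vertex`:
# a Galois-STABLE blow-up of `X_L` is a blow-up along the Galois-INVARIANT norm ideal

Route `ResolutionOfSingularities/AbhyankarShadows` (crux shared verbatim with the routes Descent /
RisoStrata / UniformComplexity / EquisingularLift / TropicalLinks / TeissierJung /
AnalyticWildDescent), line `npc-fixed-vertex`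
(`Cruxes/DescentAlgclosedToPerfect/Lines/npc-fixed-vertex.lean`), registered stub
`stub_invariantIdeal_of_stableRegularBlowup` — the first lemma of the idea card
`Cruxes/DescentAlgclosedToPerfect/Ideas/npc-fixed-vertex.md`.

Let `L/k` be a finite extension of fields, `X` a `k`-scheme, `X_L = X ×_k Spec L` its base change
with the Galois automorphisms `gal σ = 1 × Spec(σ⁻¹)`, `σ ∈ Aut(L/k)` (`GaloisDescent.gal`,
Görtz–Wedhorn I, §(14.20)), `I` an ideal sheaf on `X_L` and `ρ : Y ⟶ X_L` a blow-up of `X_L`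
along `I` in the sense of the universal property (`IsBlowup`, Görtz–Wedhorn I, Def. 13.90). If
`ρ` is ALSO a blow-up along every Galois conjugate `(gal σ)⁻¹ I · 𝒪_{X_L}` of its centre
("stable"), then `ρ` is a blow-up along the NORM IDEAL `N(I) = ∏_{σ ∈ Aut(L/k)} (gal σ)⁻¹ I · 𝒪`,
which is invariant under every `gal τ`; and `N(I) ≠ ⊥` as soon as `X_L` is reduced and `I ≠ ⊥`
(indeed every centre of such a `ρ` is `≠ ⊥`). Contents:

* `isBlowup_mul` — **blowing up in a product without changing the scheme**: if `π` is a blow-up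
  along `K` and along `K'` then it is a blow-up along `K · K'` (`π⁻¹(KK')𝒪 = π⁻¹K𝒪 · π⁻¹K'𝒪` is
  an effective Cartier divisor, Stacks 01WU; a morphism along which `KK'` becomes invertible
  makes `K` invertible, Stacks 07ZV — the case `X'' = X'` of Stacks 080A, cf. `IsBlowup.comp` and
  `IsBlowup.mul_of_isEffectiveCartier` of `Literature/…/BlowupsProduct`);
  `isBlowup_finsetProd` — hence along every non-empty finite product of such centres;
* `comap_finsetProd` — inverse image of ideal sheaves is multiplicative on finite products;
  `comap_gal_prod_comap_gal` — `(gal τ)⁻¹ N(I) 𝒪 = N(I)` (`gal (σ τ) = gal τ ≫ gal σ`, reindex the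
  product along `σ ↦ σ τ`);
* `isBlowup_prod_comap_gal` — a stable blow-up is a blow-up along `N(I)`;
* `isEmpty_of_isEffectiveCartier_bot`, `ne_bot_of_isBlowup_of_isBlowup` — a blow-up along `⊥` is
  the empty scheme, whereas a blow-up of a reduced scheme along some `I ≠ ⊥` is an isomorphism
  over the non-empty open `X ∖ V(I)` (Stacks 02OS, `IsBlowup.isIso_compl`), hence non-empty: every
  centre of `ρ` is `≠ ⊥`;
* `exists_galoisInvariant_of_forall_isBlowup_comap_gal` (any universe, any finite `L/k`) and the
  registered stub `stub_invariantIdeal_of_stableRegularBlowup` (its `Type`-level, finite Galois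
  instance, with the exact registered signature).

In the line's composition the output feeds
`Theorems.descentAlgclosedToPerfect_of_galoisInvariantResolvingIdeal`
(`Theorems/RisoStrataDescentAlgclosedToPerfectGaloisInvariant.lean`): a Galois-invariant resolving
ideal at a finite Galois level descends (Kollár 2007, 3.34.2 / Thm. 3.36).

## Sources

* The Stacks Project, Tag 080A (blowing up in a product of ideals), Tag 01WU, Tag 07ZV, Tag 02OS.
  [StacksProject]
* J. Kollár, *Lectures on Resolution of Singularities*, Annals of Math. Studies 166 (2007), 3.34.2
  (functoriality of resolutions under field extensions / Galois descent) and Thm. 3.36. [Kollar2007]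
* U. Görtz, T. Wedhorn, *Algebraic Geometry I*, 2nd ed. (2020), Def. 13.90, §(14.20).
  [GortzWedhorn2020]
-/

noncomputable section

set_option linter.dupNamespace false -- mandated namespace of this single-conjunct summit

open CategoryTheory CategoryTheory.Limits AlgebraicGeometry
open Literature.AlgebraicGeometry.Resolution Literature.AlgebraicGeometry.Motives

namespace Summit.ResolutionOfSingularities.ResolutionOfSingularities.Theorems

universe u

/-! ## Blowing up in a product of two centres of the same blow-up -/

/-- **Blowing up in a product, same scheme** (the case `X'' = X'` of Stacks, Tag 080A): if
`π : X' ⟶ X` is a blow-up of `X` along `K` and also along `K'`, then it is a blow-up of `X` along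
`K · K'`. The exceptional ideal `π⁻¹(KK')𝒪 = π⁻¹K𝒪 · π⁻¹K'𝒪` is a product of two effective
Cartier divisors (Stacks 01WU); a morphism `f` with `f⁻¹(KK')𝒪` invertible has `f⁻¹K𝒪`
invertible (Stacks 07ZV), so it factors uniquely through `π`.
[cite: StacksProject, Tag 080A; Kollar2007, 3.34.2] -/
theorem isBlowup_mul {X' X : Scheme.{u}} {π : X' ⟶ X} {K K' : X.IdealSheafData}
    (h : IsBlowup π K) (h' : IsBlowup π K') : IsBlowup π (K * K') := by
  constructor
  · rw [comap_mul]
    exact h.isEffectiveCartier.mul h'.isEffectiveCartier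
  · intro W f hf
    rw [comap_mul] at hf
    exact h.universal f hf.of_mul_left

/-- A morphism which is a blow-up along each of finitely many (at least one) centres `K i`,
`i ∈ s`, is a blow-up along their product `∏_{i ∈ s} K i`.
[cite: StacksProject, Tag 080A; Kollar2007, 3.34.2] -/
theorem isBlowup_finsetProd {X' X : Scheme.{u}} {π : X' ⟶ X} {ι : Type*} {s : Finset ι}
    (hs : s.Nonempty) {K : ι → X.IdealSheafData} (h : ∀ i ∈ s, IsBlowup π (K i)) :
    IsBlowup π (∏ i ∈ s, K i) :=
  Finset.prod_induction_nonempty K (IsBlowup π) (fun _ _ ha hb => isBlowup_mul ha hb) hs h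

/-! ## Inverse images of finite products of ideal sheaves -/

/-- **Inverse image commutes with finite products of ideal sheaves**:
`f⁻¹(∏ᵢ Kᵢ) 𝒪_X = ∏ᵢ f⁻¹Kᵢ 𝒪_X` (from `comap_mul` and `comap_top`).
[cite: StacksProject, Tag 080A; Kollar2007, 3.34.2] -/
theorem comap_finsetProd {X Y : Scheme.{u}} (f : X ⟶ Y) {ι : Type*} (s : Finset ι)
    (K : ι → Y.IdealSheafData) : (∏ i ∈ s, K i).comap f = ∏ i ∈ s, (K i).comap f := by
  refine Finset.prod_hom_rel
    (r := fun (A : Y.IdealSheafData) (B : X.IdealSheafData) => A.comap f = B) ?_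
    fun i A B hAB => ?_
  · rw [Scheme.IdealSheafData.one_eq_top, Scheme.IdealSheafData.one_eq_top,
      Scheme.IdealSheafData.comap_top]
  · rw [comap_mul, hAB]

/-! ## The norm ideal of an ideal sheaf on `X_L` is Galois-invariant -/

section Galois

variable {k : Type u} [Field k] (L : Type u) [Field L] [Algebra k L] [FiniteDimensional k L]
  (X : SchemeOver k)

/-- **The norm ideal `N(I) = ∏_{σ ∈ Aut(L/k)} (gal σ)⁻¹ I 𝒪` is Galois-invariant**:
`(gal τ)⁻¹ N(I) 𝒪 = ∏_σ (gal τ ≫ gal σ)⁻¹ I 𝒪 = ∏_σ (gal (σ τ))⁻¹ I 𝒪 = N(I)`, reindexing along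
the bijection `σ ↦ σ τ` of `Aut(L/k)`. [cite: StacksProject, Tag 080A; Kollar2007, 3.34.2] -/
theorem comap_gal_prod_comap_gal (I : (GaloisDescent.bc L X).IdealSheafData) (τ : L ≃ₐ[k] L) :
    (∏ σ : L ≃ₐ[k] L, I.comap (GaloisDescent.gal L X σ)).comap (GaloisDescent.gal L X τ) =
      ∏ σ : L ≃ₐ[k] L, I.comap (GaloisDescent.gal L X σ) := by
  rw [comap_finsetProd]
  simp_rw [← Scheme.IdealSheafData.comap_comp, ← GaloisDescent.gal_mul]
  exact Fintype.prod_equiv (Equiv.mulRight τ) _ _ fun σ => rfl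

variable {L X} in
/-- **A Galois-stable blow-up is a blow-up along the norm ideal**: if `ρ : Y ⟶ X_L` is a blow-up
along every conjugate `(gal σ)⁻¹ I 𝒪`, `σ ∈ Aut(L/k)`, then it is a blow-up along
`N(I) = ∏_σ (gal σ)⁻¹ I 𝒪`. [cite: StacksProject, Tag 080A; Kollar2007, 3.34.2] -/
theorem isBlowup_prod_comap_gal {I : (GaloisDescent.bc L X).IdealSheafData} {Y : Scheme.{u}}
    {ρ : Y ⟶ GaloisDescent.bc L X}
    (hst : ∀ σ : L ≃ₐ[k] L, IsBlowup ρ (I.comap (GaloisDescent.gal L X σ))) :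
    IsBlowup ρ (∏ σ : L ≃ₐ[k] L, I.comap (GaloisDescent.gal L X σ)) :=
  isBlowup_finsetProd Finset.univ_nonempty fun σ _ => hst σ

end Galois

/-! ## Every centre of a blow-up of a reduced scheme along a non-zero ideal is non-zero -/

/-- If the zero ideal sheaf of `W` is an effective Cartier divisor then `W` is empty: a local
equation would be the regular element `0` of the coordinate ring of an affine open containing a
point, whose basic open `D(0) = ∅` is non-empty (`nonempty_basicOpen_of_mem_nonZeroDivisors`).
[cite: GortzWedhorn2020, Def. 13.90; StacksProject, Tag 080A] -/
theorem isEmpty_of_isEffectiveCartier_bot {W : Scheme.{u}}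
    (h : IsEffectiveCartier (⊥ : W.IdealSheafData)) : IsEmpty W := by
  refine ⟨fun x => ?_⟩
  obtain ⟨V, hxV, g, hg, hV⟩ := h x
  rw [Scheme.IdealSheafData.ideal_bot, Pi.bot_apply, eq_comm, Ideal.span_singleton_eq_bot] at hV
  obtain ⟨y, hy⟩ := nonempty_basicOpen_of_mem_nonZeroDivisors V hxV g hg
  rw [hV, Scheme.basicOpen_zero, TopologicalSpace.Opens.coe_bot] at hy
  exact Set.notMem_empty y hy

/-- **Every centre of a blow-up of a reduced scheme along a non-zero ideal sheaf is non-zero.**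
If `π : X' ⟶ X` is a blow-up of the reduced scheme `X` along `I ≠ ⊥` and also along `J`, then
`J ≠ ⊥`: over the non-empty open `X ∖ V(I)` (`centreCompl_nonempty`) the blow-up `π` is an
isomorphism (Stacks 02OS, `IsBlowup.isIso_compl`), so `X'` has a point, whereas a blow-up along
`⊥` is empty (`π⁻¹(⊥)𝒪 = ⊥` would be an effective Cartier divisor).
[cite: StacksProject, Tag 02OS; Kollar2007, 3.34.2] -/
theorem ne_bot_of_isBlowup_of_isBlowup {X' X : Scheme.{u}} [IsReduced X] {π : X' ⟶ X}
    {I J : X.IdealSheafData} (hI0 : I ≠ ⊥) (hπ : IsBlowup π I) (hJ : IsBlowup π J) : J ≠ ⊥ := by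
  rintro rfl
  have hE : IsEffectiveCartier (⊥ : X'.IdealSheafData) := by
    simpa only [Scheme.IdealSheafData.comap_bot] using hJ.isEffectiveCartier
  haveI : IsIso (π ∣_ centreCompl I) := hπ.isIso_compl
  obtain ⟨x, hx⟩ := centreCompl_nonempty (J := I) hI0
  exact (isEmpty_of_isEffectiveCartier_bot hE).false ((asIso (π ∣_ centreCompl I)).inv ⟨x, hx⟩).1

/-! ## The stub: a stable blow-up is a blow-up along a non-zero Galois-invariant ideal -/

/-- **A Galois-stable blow-up of `X_L` is a blow-up along a non-zero Galois-invariant ideal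
sheaf.** Let `L/k` be a finite field extension, `X` a `k`-scheme with `X_L = X ×_k Spec L`
reduced, `I ≠ ⊥` an ideal sheaf on `X_L` and `ρ : Y ⟶ X_L` a blow-up along `I` which is also a
blow-up along every conjugate `(gal σ)⁻¹ I 𝒪`, `σ ∈ Aut(L/k)`. Then `ρ` is a blow-up along a
non-zero ideal sheaf `J` with `(gal σ)⁻¹ J 𝒪 = J` for all `σ` — the norm ideal
`J = ∏_σ (gal σ)⁻¹ I 𝒪`. [cite: StacksProject, Tag 080A; Kollar2007, 3.34.2] -/
theorem exists_galoisInvariant_of_forall_isBlowup_comap_gal {k : Type u} [Field k] (L : Type u)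
    [Field L] [Algebra k L] [FiniteDimensional k L] (X : SchemeOver k)
    [IsReduced (GaloisDescent.bc L X)]
    {I : (GaloisDescent.bc L X).IdealSheafData} (hI0 : I ≠ ⊥) {Y : Scheme.{u}}
    {ρ : Y ⟶ GaloisDescent.bc L X} (hρ : IsBlowup ρ I)
    (hst : ∀ σ : L ≃ₐ[k] L, IsBlowup ρ (I.comap (GaloisDescent.gal L X σ))) :
    ∃ J : (GaloisDescent.bc L X).IdealSheafData, J ≠ ⊥ ∧
      (∀ σ : L ≃ₐ[k] L, J.comap (GaloisDescent.gal L X σ) = J) ∧ IsBlowup ρ J :=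
  ⟨∏ σ : L ≃ₐ[k] L, I.comap (GaloisDescent.gal L X σ),
    ne_bot_of_isBlowup_of_isBlowup hI0 hρ (isBlowup_prod_comap_gal hst),
    comap_gal_prod_comap_gal L X I, isBlowup_prod_comap_gal hst⟩

/-- STUB `stub_invariantIdeal_of_stableRegularBlowup` of the line `npc-fixed-vertex` (the idea
card's first lemma `invariantIdeal_of_stableRegularBlowup`), with its registered signature. Let
`L/k` be finite Galois, `X` a `k`-scheme with `X_L = X ×_k Spec L` reduced, `I ≠ ⊥` an ideal sheaf
on `X_L`, and `ρ : Y ⟶ X_L` a blow-up along `I` which is ALSO a blow-up along every Galois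
conjugate `(gal σ)⁻¹ I · 𝒪`. Then `ρ` is a blow-up along a non-zero Galois-INVARIANT ideal sheaf
`J` (the norm ideal `∏_σ (gal σ)⁻¹ I`). [cite: StacksProject, Tag 080A; Kollar2007, 3.34.2] -/
theorem stub_invariantIdeal_of_stableRegularBlowup {k : Type} [Field k] (L : Type) [Field L]
    [Algebra k L] [FiniteDimensional k L] [IsGalois k L] (X : SchemeOver k)
    [IsReduced (GaloisDescent.bc L X)]
    {I : (GaloisDescent.bc L X).IdealSheafData} (hI0 : I ≠ ⊥) {Y : Scheme.{0}}
    {ρ : Y ⟶ GaloisDescent.bc L X} (hρ : IsBlowup ρ I)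
    (hst : ∀ σ : L ≃ₐ[k] L, IsBlowup ρ (I.comap (GaloisDescent.gal L X σ))) :
    ∃ J : (GaloisDescent.bc L X).IdealSheafData, J ≠ ⊥ ∧
      (∀ σ : L ≃ₐ[k] L, J.comap (GaloisDescent.gal L X σ) = J) ∧ IsBlowup ρ J :=
  exists_galoisInvariant_of_forall_isBlowup_comap_gal L X hI0 hρ hst

/-! ## Appendix (lead, cycle 1): the DOMINATION criterion — `Y` need only dominate its conjugates

The hypothesis "`ρ` is a blow-up along every conjugate centre" can be weakened to "every conjugate
centre becomes an effective Cartier divisor on `Y`", i.e. `Y = Bl_I X_L` merely DOMINATES each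
conjugate blow-up `Bl_{σ I} X_L` (idea card `same-time-domination`, idea-node g25; crux notes §6):
the universal property of `Bl_{∏_σ σI}` only ever uses the factor `I` (the tree's
`IsBlowup.mul_of_isEffectiveCartier_comap`, `Literature/…/StrictTransformOpenImmersion`). So
"domination, not regularity" (the recorded dead end of the norm-ideal device) becomes: domination
BY A REGULAR MODEL suffices. -/

/-- **Twisting a centre by finitely many ideals that are invertible upstairs**: a blow-up along `K`
on which every `π⁻¹(K' i)𝒪` (`i ∈ s`) is an effective Cartier divisor is a blow-up along
`K · ∏_{i ∈ s} K' i` (iterate the tree's `IsBlowup.mul_of_isEffectiveCartier_comap`: the universal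
property of `Bl_{KK'}` needs only `f⁻¹K𝒪` invertible, Stacks 07ZV). [cite: StacksProject, Tag 080A] -/
theorem isBlowup_mul_finsetProd_of_isEffectiveCartier_comap {X' X : Scheme.{u}} {π : X' ⟶ X}
    {K : X.IdealSheafData} (h : IsBlowup π K) {ι : Type*} (s : Finset ι)
    {K' : ι → X.IdealSheafData} (h' : ∀ i ∈ s, IsEffectiveCartier ((K' i).comap π)) :
    IsBlowup π (K * ∏ i ∈ s, K' i) := by
  classical
  induction s using Finset.induction_on with
  | empty => simpa only [Finset.prod_empty, mul_one] using h
  | insert i s hi ih =>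
    rw [Finset.prod_insert hi, mul_left_comm, mul_comm]
    exact (ih fun j hj => h' j (Finset.mem_insert_of_mem hj)).mul_of_isEffectiveCartier_comap
      (h' i (Finset.mem_insert_self i s))

/-- **Domination criterion.** Let `L/k` be a finite field extension, `X` a `k`-scheme with `X_L`
reduced, `I ≠ ⊥` an ideal sheaf on `X_L` and `ρ : Y ⟶ X_L` a blow-up along `I` such that every
conjugate centre `(gal σ)⁻¹ I 𝒪` becomes an effective Cartier divisor on `Y` (equivalently: `Y`
dominates every conjugate blow-up `Bl_{σI} X_L` over `X_L`). Then `ρ` is a blow-up along a non-zero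
ideal sheaf `J` with `(gal σ)⁻¹ J 𝒪 = J` for all `σ` (the norm ideal). With `Y` regular and `L/k`
Galois this feeds `Theorems.hasResolution_of_isBlowup_galoisInvariant`: a regular blow-up model of
`X_L` dominating all its Galois conjugates descends to a resolution of `X`.
[cite: StacksProject, Tag 080A; Kollar2007, 3.34.2] -/
theorem exists_galoisInvariant_of_forall_isEffectiveCartier_comap_gal {k : Type u} [Field k]
    (L : Type u) [Field L] [Algebra k L] [FiniteDimensional k L] (X : SchemeOver k)
    [IsReduced (GaloisDescent.bc L X)]
    {I : (GaloisDescent.bc L X).IdealSheafData} (hI0 : I ≠ ⊥) {Y : Scheme.{u}}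
    {ρ : Y ⟶ GaloisDescent.bc L X} (hρ : IsBlowup ρ I)
    (hdom : ∀ σ : L ≃ₐ[k] L,
      IsEffectiveCartier ((I.comap (GaloisDescent.gal L X σ)).comap ρ)) :
    ∃ J : (GaloisDescent.bc L X).IdealSheafData, J ≠ ⊥ ∧
      (∀ σ : L ≃ₐ[k] L, J.comap (GaloisDescent.gal L X σ) = J) ∧ IsBlowup ρ J := by
  classical
  have hJ : IsBlowup ρ (∏ σ : L ≃ₐ[k] L, I.comap (GaloisDescent.gal L X σ)) := by
    have h1 : I.comap (GaloisDescent.gal L X 1) = I := by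
      rw [GaloisDescent.gal_one, Scheme.IdealSheafData.comap_id]
    rw [← Finset.mul_prod_erase Finset.univ _ (Finset.mem_univ (1 : L ≃ₐ[k] L)), h1]
    exact isBlowup_mul_finsetProd_of_isEffectiveCartier_comap hρ _ fun σ _ => hdom σ
  exact ⟨_, ne_bot_of_isBlowup_of_isBlowup hI0 hρ hJ, comap_gal_prod_comap_gal L X I, hJ⟩

end Summit.ResolutionOfSingularities.ResolutionOfSingularities.Theorems

end
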